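import Mathlib.FieldTheory.KummerPolynomial
import Mathlib.Algebra.Polynomial.GroupRingAction
import Mathlib.RingTheory.RootsOfUnity.Basic
import Literature.NumberTheory.DiophantineGeometry.PlaneCurveFunctionFieldProofs
import Literature.NumberTheory.GaloisRepresentations.AbsGaloisGroup
import HarnessLib

/-!
# The function field of a superelliptic curve `y^m = f(x)` and the actions of `Aut(L/K)` and `μ_m`

For a field `K`, a `K`-algebra field `L` (intended: `L = K̄`), `m : ℕ`, `f ∈ K[X]`, the curve
`C_f : y^m = f(x)` has function field `L(C_f) = L(x)[Y]/(Y^m - f(x))` over `L`, realised as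
`SuperellipticFunctionField K L m f := AdjoinRoot (superellipticPoly K L m f)`,
`superellipticPoly K L m f = Y^m - C(f) ∈ (RatFunc L)[Y]` — the plane-curve model of the tree's
`PlaneCurveFunctionFieldProofs` (a field through `AdjoinRoot.instField` under `Fact (Irreducible _)`;
`irreducible_superellipticPoly` proves it for `m = p` prime, `f` separable non-constant;
`instIsAlgFunctionField`: `L(C_f)/L` is an algebraic function field of one variable, so the
Stichtenoth library `DiophantineGeometry.AlgFunctionField` — places, divisors, `Cl`, Riemann–Roch —
applies).  Actions, all by genuine ring homomorphisms:
* `instMulSemiringActionRatFunc` — a group acting on `L` by ring automorphisms acts on `L(x)`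
  coefficientwise (Mathlib's action on `L[X]` extended by `IsFractionRing.ringEquivOfRingEquivHom`);
* `adjoinRootMulSemiringAction` — `G` acts on `R[Y]/(Φ)` when every `g` fixes `Φ` (`AdjoinRoot.lift`);
* `instMulSemiringActionSuperellipticFunctionField` — for `G` acting on `L` over `K`
  (`SMulCommClass G K L`: `G = L ≃ₐ[K] L`, or `Field.absoluteGaloisGroup K` on `L = K̄` through the
  tree's `AbsGaloisGroup`), `Y^m - f` is `G`-fixed, whence the **Galois action on `L(C_f)`**,
  semilinear over `L` (`smul_algebraMap_superelliptic`), fixing `x` and `y`;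
* `instMulSemiringActionDeck` — the **deck transformations `y ↦ ζ y`**, `ζ ∈ μ_m(L)` (group
  `CyclicCoverDeck L m`, a synonym of `rootsOfUnity m L`, which itself already acts on `L`-modules
  by scalars), by `L(x)`-algebra automorphisms (`AdjoinRoot.liftAlgHom`): the automorphism `δ_q`
  (Zarhin) / `ζ` (Poonen–Schaefer) of the curve and of its Jacobian.
The induced actions on places, divisor classes and `J[n]` are in `DivisorClassGaloisAction` and
`SuperellipticTorsionRep`.

References: Yu. G. Zarhin, *Endomorphism algebras of abelian varieties with special reference to
superelliptic Jacobians*, Springer PROMS 251 (2018) = arXiv:1706.00110, §8 (`C_{f,q}`, `δ_q`)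
[Zarhin2018SuperellipticJacobians]; B. Poonen, E. F. Schaefer, J. reine angew. Math. 488 (1997)
(the curves `y^p = f(x)`; paywalled, acquisition acq-02834, cited through Zarhin) [PoonenSchaefer1997];
H. Stichtenoth, *Algebraic Function Fields and Codes* (2009), Def. 1.1.1 [Stichtenoth2009].
-/

noncomputable section

open Polynomial

namespace Literature.NumberTheory.GaloisRepresentations

universe u v w

/-! ### Coefficientwise action of field automorphisms on rational functions -/

section RatFuncAction

variable (L : Type v) [Field L] (G : Type w) [Group G] [MulSemiringAction G L]

/-- The homomorphism `G → Aut(L(x))`: `g` acts on `L[X]` coefficientwise (Mathlib's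
`MulSemiringAction G L[X]`) and the ring automorphism extends uniquely to the fraction field
`RatFunc L` (`IsFractionRing.ringEquivOfRingEquivHom`). [folklore] -/
def ratFuncAutHom : G →* (RatFunc L ≃+* RatFunc L) :=
  (IsFractionRing.ringEquivOfRingEquivHom L[X] (RatFunc L)).comp
    (MulSemiringAction.toRingEquiv G L[X])

/-- **Field automorphisms act on rational functions coefficientwise**: the action of `G` on
`L(x) = RatFunc L` through `ratFuncAutHom` (no Mathlib instance of this type exists; the guard
`IsScalarTower G L[X] L[X]` of Mathlib's localization actions fails for automorphism actions,
so nothing is duplicated). [folklore] -/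
instance instMulSemiringActionRatFunc : MulSemiringAction G (RatFunc L) :=
  MulSemiringAction.compHom (RatFunc L) (ratFuncAutHom L G)

variable {L G}

/-- Unfolding of the action on `RatFunc L`. [folklore] -/
theorem smul_ratFunc_def (g : G) (x : RatFunc L) :
    g • x = IsFractionRing.ringEquivOfRingEquiv (MulSemiringAction.toRingEquiv G L[X] g) x :=
  rfl

/-- On polynomials the action is the coefficientwise one: `g • (q : L(x)) = (g • q : L(x))`. [folklore] -/
@[simp]
theorem smul_algebraMap_polynomial (g : G) (q : L[X]) :
    g • algebraMap L[X] (RatFunc L) q = algebraMap L[X] (RatFunc L) (g • q) := by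
  rw [smul_ratFunc_def, IsFractionRing.ringEquivOfRingEquiv_algebraMap]
  rfl

/-- On constants the action is that of `G` on `L`: `g • (c : L(x)) = (g c : L(x))`. [folklore] -/
@[simp]
theorem smul_algebraMap_ratFunc (g : G) (c : L) :
    g • algebraMap L (RatFunc L) c = algebraMap L (RatFunc L) (g • c) := by
  simp only [IsScalarTower.algebraMap_apply L L[X] (RatFunc L), Polynomial.algebraMap_eq,
    smul_algebraMap_polynomial, Polynomial.smul_C]

/-- The variable is fixed: `g • x = x`. [folklore] -/
@[simp]
theorem smul_ratFunc_X (g : G) : g • (RatFunc.X : RatFunc L) = RatFunc.X := by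
  rw [← RatFunc.algebraMap_X, smul_algebraMap_polynomial, Polynomial.smul_X]

end RatFuncAction

/-! ### Action on `R[Y]/(Φ)` for a `G`-fixed polynomial `Φ` -/

section AdjoinRootAction

variable {R : Type u} [CommRing R] {G : Type w} [Group G] [MulSemiringAction G R]

/-- `g • Φ = g(Φ)` (coefficientwise), pointwise form of Mathlib's `Polynomial.smul_eq_map`. [folklore] -/
theorem smul_eq_map_apply (g : G) (Φ : R[X]) :
    g • Φ = Φ.map (MulSemiringAction.toRingHom G R g) :=
  congrFun (Polynomial.smul_eq_map R g) Φ

/-- For `g` fixing `Φ`, the ring endomorphism of `R[Y]/(Φ)` induced by `g` on coefficients and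
`y ↦ y` (`AdjoinRoot.lift`; well defined because `Φ(y) = (g Φ)(y) = 0`). [folklore] -/
def adjoinRootSMulHom (Φ : R[X]) (g : G) (hΦ : g • Φ = Φ) : AdjoinRoot Φ →+* AdjoinRoot Φ :=
  AdjoinRoot.lift ((AdjoinRoot.of Φ).comp (MulSemiringAction.toRingHom G R g)) (AdjoinRoot.root Φ)
    (by
      rw [← Polynomial.eval₂_map, ← smul_eq_map_apply, hΦ]
      exact AdjoinRoot.eval₂_root Φ)

/-- `adjoinRootSMulHom` on the class of a polynomial: `[q] ↦ [g • q]`. [folklore] -/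
theorem adjoinRootSMulHom_mk (Φ : R[X]) (g : G) (hΦ : g • Φ = Φ) (q : R[X]) :
    adjoinRootSMulHom Φ g hΦ (AdjoinRoot.mk Φ q) = AdjoinRoot.mk Φ (g • q) := by
  rw [adjoinRootSMulHom, AdjoinRoot.lift_mk, ← Polynomial.eval₂_map, ← smul_eq_map_apply,
    ← AdjoinRoot.algebraMap_eq, ← Polynomial.aeval_def, AdjoinRoot.aeval_eq]

/-- `adjoinRootSMulHom` on constants: `r ↦ g • r`. [folklore] -/
theorem adjoinRootSMulHom_of (Φ : R[X]) (g : G) (hΦ : g • Φ = Φ) (r : R) :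
    adjoinRootSMulHom Φ g hΦ (AdjoinRoot.of Φ r) = AdjoinRoot.of Φ (g • r) := by
  rw [← AdjoinRoot.mk_C, adjoinRootSMulHom_mk, Polynomial.smul_C, AdjoinRoot.mk_C]

/-- `adjoinRootSMulHom` fixes the root `y`. [folklore] -/
theorem adjoinRootSMulHom_root (Φ : R[X]) (g : G) (hΦ : g • Φ = Φ) :
    adjoinRootSMulHom Φ g hΦ (AdjoinRoot.root Φ) = AdjoinRoot.root Φ := by
  rw [AdjoinRoot.root, adjoinRootSMulHom_mk, Polynomial.smul_X]

variable (G) in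
/-- **The action of `G` on `R[Y]/(Φ)` when every `g ∈ G` fixes `Φ`**: `g • [q] = [g • q]`, by ring
endomorphisms (hence automorphisms, `G` being a group).  A reducible `def`; it is instantiated
below for superelliptic function fields. [folklore] -/
abbrev adjoinRootMulSemiringAction (Φ : R[X]) (hΦ : ∀ g : G, g • Φ = Φ) :
    MulSemiringAction G (AdjoinRoot Φ) where
  smul g x := adjoinRootSMulHom Φ g (hΦ g) x
  one_smul x := by
    induction x using AdjoinRoot.induction_on with
    | ih q =>
      change adjoinRootSMulHom Φ 1 (hΦ 1) (AdjoinRoot.mk Φ q) = AdjoinRoot.mk Φ q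
      rw [adjoinRootSMulHom_mk, one_smul]
  mul_smul g h x := by
    induction x using AdjoinRoot.induction_on with
    | ih q =>
      change adjoinRootSMulHom Φ (g * h) (hΦ (g * h)) (AdjoinRoot.mk Φ q) =
        adjoinRootSMulHom Φ g (hΦ g) (adjoinRootSMulHom Φ h (hΦ h) (AdjoinRoot.mk Φ q))
      rw [adjoinRootSMulHom_mk, adjoinRootSMulHom_mk, adjoinRootSMulHom_mk, mul_smul]
  smul_zero g := map_zero (adjoinRootSMulHom Φ g (hΦ g))
  smul_add g := map_add (adjoinRootSMulHom Φ g (hΦ g))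
  smul_one g := map_one (adjoinRootSMulHom Φ g (hΦ g))
  smul_mul g := map_mul (adjoinRootSMulHom Φ g (hΦ g))

end AdjoinRootAction

/-! ### The superelliptic function field -/

section Superelliptic

variable (K : Type u) [Field K] (L : Type v) [Field L] [Algebra K L] (m : ℕ) (f : K[X])

/-- The plane model `Y^m - f(x) ∈ L(x)[Y]` of the superelliptic curve `C_f : y^m = f(x)`, `f ∈ K[X]`,
over the extension `L ⊇ K` (the curves of Poonen–Schaefer 1997; Zarhin 2018 §8, `C_{f,q}`).
[cite: Zarhin2018SuperellipticJacobians, §8] -/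
def superellipticPoly : (RatFunc L)[X] :=
  X ^ m - C (algebraMap L[X] (RatFunc L) (f.map (algebraMap K L)))

/-- `Y^m - f(x)` is monic in `Y` for `m ≠ 0`. [folklore] -/
theorem monic_superellipticPoly (hm : m ≠ 0) : (superellipticPoly K L m f).Monic :=
  monic_X_pow_sub_C _ hm

/-- `deg_Y (Y^m - f(x)) = m`. [folklore] -/
theorem natDegree_superellipticPoly : (superellipticPoly K L m f).natDegree = m :=
  natDegree_X_pow_sub_C

/-- **`Y^p - f(x)` is irreducible over `L(x)`** for `p` prime and `f` separable non-constant: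
by Mathlib's `X_pow_sub_C_irreducible_of_prime` it suffices that `f` is not a `p`-th power in
`L(x)`; a `p`-th root `b` would be integral over the integrally closed `L[x]`, hence a polynomial
`c` with `c^p = f`, contradicting squarefreeness of `f`. [folklore] -/
theorem irreducible_superellipticPoly {p : ℕ} (hp : p.Prime) (hsep : f.Separable)
    (hdeg : 0 < f.natDegree) : Irreducible (superellipticPoly K L p f) := by
  have hsq : Squarefree (f.map (algebraMap K L)) := hsep.map.squarefree
  have hdeg' : 0 < (f.map (algebraMap K L)).natDegree := by rwa [Polynomial.natDegree_map]
  refine X_pow_sub_C_irreducible_of_prime hp fun b hb => ?_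
  have hint : IsIntegral L[X] b := by
    refine IsIntegral.of_pow hp.pos ?_
    rw [hb]
    exact isIntegral_algebraMap
  obtain ⟨c, rfl⟩ := IsIntegrallyClosed.isIntegral_iff.mp hint
  rw [← map_pow] at hb
  have hcg : c ^ p = f.map (algebraMap K L) := IsFractionRing.injective L[X] (RatFunc L) hb
  have hc : IsUnit c := hsq c
    ⟨c ^ (p - 2), by rw [← hcg, ← pow_two, ← pow_add, Nat.add_sub_cancel' hp.two_le]⟩
  have hu : IsUnit (f.map (algebraMap K L)) := hcg ▸ hc.pow p
  exact absurd (natDegree_eq_zero_of_isUnit hu) hdeg'.ne'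

/-- The `Fact` instance needed to see `L(C_f)` as a field, for `p` prime and `f` separable
non-constant (use with `haveI`). [folklore] -/
theorem fact_irreducible_superellipticPoly {p : ℕ} [hp : Fact p.Prime] (hsep : f.Separable)
    (hdeg : 0 < f.natDegree) : Fact (Irreducible (superellipticPoly K L p f)) :=
  ⟨irreducible_superellipticPoly K L f hp.out hsep hdeg⟩

/-- The same `Fact` for `L = K̄ = AlgebraicClosure K`, with the `K`-algebra structure of `K̄` fixed
inside the statement (Mathlib's `AlgebraicClosure.instAlgebra`, the one used by
`Field.absoluteGaloisGroup` and by the `K̄`-specialisations of `SuperellipticTorsionRep`; for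
`K = ℚ` a bare `Algebra ℚ (AlgebraicClosure ℚ)` at a call site resolves to the `Rat.cast` algebra
instead, a propositionally equal but syntactically different instance). [folklore] -/
theorem fact_irreducible_superellipticPoly_algebraicClosure {p : ℕ} [hp : Fact p.Prime]
    (hsep : f.Separable) (hdeg : 0 < f.natDegree) :
    Fact (Irreducible (superellipticPoly K (AlgebraicClosure K) p f)) :=
  fact_irreducible_superellipticPoly K (AlgebraicClosure K) f hsep hdeg

/-- **The function field `L(C_f) = L(x)[y]/(y^m - f(x))`** of the superelliptic curve
`C_f : y^m = f(x)` over `L ⊇ K` (an `abbrev` for `AdjoinRoot`, so that Mathlib's `AdjoinRoot.root`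
(`= y`), `AdjoinRoot.instField` (under `Fact (Irreducible (superellipticPoly K L m f))`),
`AdjoinRoot.powerBasis`, … apply verbatim): the function field `K_a(C_{f,q})` of Zarhin 2018 §§8–9
(the curves of Poonen–Schaefer 1997). [cite: Zarhin2018SuperellipticJacobians, §8] -/
abbrev SuperellipticFunctionField : Type v :=
  AdjoinRoot (superellipticPoly K L m f)

/-- `L(C_f)/L` is an algebraic function field of one variable (Stichtenoth Def. 1.1.1): it has the
power basis `1, y, …, y^{m-1}` over `L(x)` (tree: `isAlgFunctionField_of_powerBasis`). Hence the
whole `AlgFunctionField` library (places, divisors, `Cl(F/L)`, genus, Riemann–Roch) applies to it.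
[cite: Stichtenoth2009, Def. 1.1.1] -/
instance instIsAlgFunctionField [Fact (Irreducible (superellipticPoly K L m f))] :
    DiophantineGeometry.IsAlgFunctionField L (SuperellipticFunctionField K L m f) :=
  DiophantineGeometry.AlgFunctionField.isAlgFunctionField_of_powerBasis
    (AdjoinRoot.powerBasis (Fact.out : Irreducible (superellipticPoly K L m f)).ne_zero)

/-! ### The Galois action on `L(C_f)` -/

variable {G : Type w} [Group G] [MulSemiringAction G L] [SMulCommClass G K L]

/-- `f ∈ K[X]` is fixed by automorphisms of `L` over `K`. [folklore] -/
theorem smul_map_algebraMap (g : G) : g • f.map (algebraMap K L) = f.map (algebraMap K L) := by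
  ext n
  rw [Polynomial.coeff_smul, Polynomial.coeff_map, smul_algebraMap]

/-- `Y^m - f(x)` is fixed by automorphisms of `L` over `K` (acting coefficientwise on `L(x)[Y]`). [folklore] -/
theorem smul_superellipticPoly (g : G) : g • superellipticPoly K L m f = superellipticPoly K L m f := by
  simp only [superellipticPoly, smul_sub, smul_pow', Polynomial.smul_X, Polynomial.smul_C,
    smul_algebraMap_polynomial, smul_map_algebraMap]

/-- **The Galois action on the function field `L(C_f)`**: a group `G` of automorphisms of `L/K`
(`MulSemiringAction G L`, `SMulCommClass G K L`; e.g. `G = L ≃ₐ[K] L`, or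
`G = Field.absoluteGaloisGroup K`, `L = AlgebraicClosure K` through the tree's `AbsGaloisGroup`
instances) acts on `L(C_f) = L(x)[y]/(y^m - f)` through its action on the coefficients `L`,
fixing `x` and `y` — the action of `Gal(K̄/K)` on `K̄(C) = K̄ ⊗_K K(C)` through the first factor
(Zarhin §1: `Gal(K)` acting on `J(K_a)`, points and divisors). [cite: Zarhin2018SuperellipticJacobians, §8] -/
instance instMulSemiringActionSuperellipticFunctionField :
    MulSemiringAction G (SuperellipticFunctionField K L m f) :=
  adjoinRootMulSemiringAction G (superellipticPoly K L m f) (smul_superellipticPoly K L m f)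

/-- `g • [q] = [g • q]` on `L(C_f)`. [folklore] -/
theorem smul_superelliptic_mk (g : G) (q : (RatFunc L)[X]) :
    g • AdjoinRoot.mk (superellipticPoly K L m f) q = AdjoinRoot.mk (superellipticPoly K L m f) (g • q) :=
  adjoinRootSMulHom_mk _ g _ q

/-- `g • (r : L(C_f)) = (g • r : L(C_f))` for `r ∈ L(x)`. [folklore] -/
@[simp]
theorem smul_superelliptic_of (g : G) (r : RatFunc L) :
    g • AdjoinRoot.of (superellipticPoly K L m f) r = AdjoinRoot.of (superellipticPoly K L m f) (g • r) :=
  adjoinRootSMulHom_of _ g _ r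

/-- The Galois action fixes `y`: `g • y = y`. [folklore] -/
@[simp]
theorem smul_superelliptic_root (g : G) :
    g • AdjoinRoot.root (superellipticPoly K L m f) = AdjoinRoot.root (superellipticPoly K L m f) :=
  adjoinRootSMulHom_root _ g _

/-- **The Galois action on `L(C_f)` is semilinear over `L`**: `g • c = g(c)` for constants
`c ∈ L`; in particular it maps the constant field `L` onto itself (so it permutes the places of
`L(C_f)/L`, file `DivisorClassGaloisAction`). [folklore] -/
@[simp]
theorem smul_algebraMap_superelliptic (g : G) (c : L) :
    g • algebraMap L (SuperellipticFunctionField K L m f) c =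
      algebraMap L (SuperellipticFunctionField K L m f) (g • c) := by
  rw [AdjoinRoot.algebraMap_eq', RingHom.comp_apply, RingHom.comp_apply, smul_superelliptic_of,
    smul_algebraMap_ratFunc]

/-! ### The automorphisms `y ↦ ζ y`, `ζ ∈ μ_m(L)` -/

end Superelliptic

section Deck

variable (L : Type v) [Field L] (m : ℕ)

/-- The group of **deck transformations** `(x, y) ↦ (x, ζ y)` of the cyclic cover
`C_f → ℙ¹`, `(x, y) ↦ x`, identified with `μ_m(L)`: a type synonym of Mathlib's
`rootsOfUnity m L`.  (A synonym, not `rootsOfUnity m L` itself, because `↥(rootsOfUnity m L) ≤ Lˣ`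
already acts on every `L`-module by *scalar* multiplication; the deck action on `L(C_f)` below is a
different action and must not create a second `SMul` instance on the same types.)
Zarhin 2018 §8 (`δ_q`). [cite: Zarhin2018SuperellipticJacobians, §8] -/
def CyclicCoverDeck : Type v := rootsOfUnity m L

/-- `μ_m(L)` is a (finite cyclic) group. [folklore] -/
instance CyclicCoverDeck.instGroup : Group (CyclicCoverDeck L m) :=
  inferInstanceAs (Group (rootsOfUnity m L))

variable {L m}

/-- The identification with Mathlib's `rootsOfUnity m L` (the identity). [folklore] -/
def CyclicCoverDeck.equivRootsOfUnity : CyclicCoverDeck L m ≃* rootsOfUnity m L :=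
  MulEquiv.refl _

/-- The root of unity `ζ ∈ L` underlying a deck transformation. [folklore] -/
def CyclicCoverDeck.val (ζ : CyclicCoverDeck L m) : L :=
  ((CyclicCoverDeck.equivRootsOfUnity ζ : Lˣ) : L)

/-- `val 1 = 1`. [folklore] -/
@[simp]
theorem CyclicCoverDeck.val_one : (1 : CyclicCoverDeck L m).val = 1 :=
  rfl

/-- `val (ζ ξ) = val ζ * val ξ`. [folklore] -/
@[simp]
theorem CyclicCoverDeck.val_mul (ζ ξ : CyclicCoverDeck L m) : (ζ * ξ).val = ζ.val * ξ.val :=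
  rfl

/-- `(val ζ)^m = 1`. [folklore] -/
@[simp]
theorem CyclicCoverDeck.val_pow (ζ : CyclicCoverDeck L m) : ζ.val ^ m = 1 := by
  have h := congrArg Units.val ((mem_rootsOfUnity m _).mp (CyclicCoverDeck.equivRootsOfUnity ζ).2)
  rwa [Units.val_pow_eq_pow_val, Units.val_one] at h

end Deck

section DeckAction

variable (K : Type u) [Field K] (L : Type v) [Field L] [Algebra K L] (m : ℕ) (f : K[X])

/-- `Φ(z) = z^m - f(x)` for the plane model `Φ = Y^m - f(x)`, in any `L(x)`-algebra. [folklore] -/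
theorem aeval_superellipticPoly {A : Type*} [CommRing A] [Algebra (RatFunc L) A] (z : A) :
    aeval z (superellipticPoly K L m f) =
      z ^ m - algebraMap (RatFunc L) A (algebraMap L[X] (RatFunc L) (f.map (algebraMap K L))) := by
  simp [superellipticPoly]

/-- The `L(x)`-algebra endomorphism `y ↦ ζ y` of `L(C_f)` for `ζ ∈ μ_m(L)`
(`AdjoinRoot.liftAlgHom`; `(ζ y)^m - f = y^m - f = 0`): the deck transformation
`(x, y) ↦ (x, ζ y)` of `C_f` acting on functions (Zarhin 2018 §8, `δ_q`; the `ζ` of Poonen–Schaefer).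
[cite: Zarhin2018SuperellipticJacobians, §8] -/
def deckAlgHom (ζ : CyclicCoverDeck L m) :
    SuperellipticFunctionField K L m f →ₐ[RatFunc L] SuperellipticFunctionField K L m f :=
  AdjoinRoot.liftAlgHom (superellipticPoly K L m f) (Algebra.ofId (RatFunc L) _)
    (algebraMap L (SuperellipticFunctionField K L m f) ζ.val *
      AdjoinRoot.root (superellipticPoly K L m f))
    (by
      change aeval (algebraMap L (SuperellipticFunctionField K L m f) ζ.val *
          AdjoinRoot.root (superellipticPoly K L m f)) (superellipticPoly K L m f) = 0
      rw [aeval_superellipticPoly, mul_pow, ← map_pow, CyclicCoverDeck.val_pow, map_one, one_mul,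
        ← aeval_superellipticPoly, AdjoinRoot.aeval_eq, AdjoinRoot.mk_self])

/-- `y ↦ ζ y`. [folklore] -/
@[simp]
theorem deckAlgHom_root (ζ : CyclicCoverDeck L m) :
    deckAlgHom K L m f ζ (AdjoinRoot.root (superellipticPoly K L m f)) =
      algebraMap L (SuperellipticFunctionField K L m f) ζ.val *
        AdjoinRoot.root (superellipticPoly K L m f) :=
  AdjoinRoot.liftAlgHom_root _ _ _ _

/-- Constants are fixed by `y ↦ ζ y`. [folklore] -/
@[simp]
theorem deckAlgHom_algebraMap (ζ : CyclicCoverDeck L m) (c : L) :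
    deckAlgHom K L m f ζ (algebraMap L (SuperellipticFunctionField K L m f) c) =
      algebraMap L (SuperellipticFunctionField K L m f) c := by
  rw [IsScalarTower.algebraMap_apply L (RatFunc L) (SuperellipticFunctionField K L m f),
    AlgHom.commutes]

/-- **The action of the deck group `μ_m(L)` on `L(C_f)` by `y ↦ ζ y`** (`L(x)`-algebra
automorphisms).  Zarhin 2018 §8 (`δ_q : (x, y) ↦ (x, ζ y)`); the automorphism `ζ` of Poonen–Schaefer.
[cite: Zarhin2018SuperellipticJacobians, §8] -/
instance instMulSemiringActionDeck :
    MulSemiringAction (CyclicCoverDeck L m) (SuperellipticFunctionField K L m f) where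
  smul ζ x := deckAlgHom K L m f ζ x
  one_smul x := by
    change deckAlgHom K L m f 1 x = x
    have h1 : deckAlgHom K L m f 1 = AlgHom.id (RatFunc L) _ :=
      AdjoinRoot.algHom_ext (by
        rw [deckAlgHom_root, AlgHom.coe_id, id_eq, CyclicCoverDeck.val_one, map_one, one_mul])
    rw [h1, AlgHom.coe_id, id_eq]
  mul_smul ζ ξ x := by
    change deckAlgHom K L m f (ζ * ξ) x = deckAlgHom K L m f ζ (deckAlgHom K L m f ξ x)
    rw [← AlgHom.comp_apply]
    congr 1
    refine AdjoinRoot.algHom_ext ?_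
    rw [AlgHom.comp_apply, deckAlgHom_root, deckAlgHom_root, map_mul, deckAlgHom_algebraMap,
      deckAlgHom_root, CyclicCoverDeck.val_mul, map_mul]
    ring
  smul_zero ζ := map_zero (deckAlgHom K L m f ζ)
  smul_add ζ := map_add (deckAlgHom K L m f ζ)
  smul_one ζ := map_one (deckAlgHom K L m f ζ)
  smul_mul ζ := map_mul (deckAlgHom K L m f ζ)

/-- Unfolding: `ζ • z = deckAlgHom ζ z`. [folklore] -/
theorem deck_smul_def (ζ : CyclicCoverDeck L m) (z : SuperellipticFunctionField K L m f) :
    ζ • z = deckAlgHom K L m f ζ z :=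
  rfl

/-- `ζ • y = ζ y`. [folklore] -/
@[simp]
theorem deck_smul_root (ζ : CyclicCoverDeck L m) :
    ζ • AdjoinRoot.root (superellipticPoly K L m f) =
      algebraMap L (SuperellipticFunctionField K L m f) ζ.val *
        AdjoinRoot.root (superellipticPoly K L m f) :=
  deckAlgHom_root K L m f ζ

/-- `ζ • (r : L(C_f)) = r` for `r ∈ L(x)`. [folklore] -/
@[simp]
theorem deck_smul_of (ζ : CyclicCoverDeck L m) (r : RatFunc L) :
    ζ • AdjoinRoot.of (superellipticPoly K L m f) r = AdjoinRoot.of (superellipticPoly K L m f) r :=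
  AdjoinRoot.liftAlgHom_of _ _ _ _ r

/-- The deck action is `L`-linear (it is even `L(x)`-linear); in particular it fixes the
constants, so it permutes the places of `L(C_f)/L`. [folklore] -/
instance instSMulCommClassDeck :
    SMulCommClass (CyclicCoverDeck L m) L (SuperellipticFunctionField K L m f) where
  smul_comm ζ c z := (deckAlgHom K L m f ζ).toLinearMap.map_smul_of_tower c z

end DeckAction


end Literature.NumberTheory.GaloisRepresentations
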